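import Literature.AlgebraicGeometry.HodgeTheory.WeilTypeCMFieldSlotsHodgeClassesOfLie
import Literature.AlgebraicGeometry.HodgeTheory.CMFieldHodgeGroupPowersHodgeClasses
import Literature.RepresentationTheory.ClassicalInvariants.MixedTensorLieInvariantsSLColoured
import HarnessLib

/-!
# The Lie-to-group passage for abelian varieties of Weil type with `End⁰ = E ⊋ K` a CM field: «`Lie Hg(H¹A) ⊗ ℂ ⊇ 𝔲_E ∩ 𝔰𝔲_K`» ⟹ «`Hg(A)(ℂ)|_{H¹} ⊇ S(A)(ℂ) ∩ {det_{W_K} = 1} = U_E(ℂ) ∩ SU_K`» (Deligne's rigidity + unipotent generation of `∏_σ SL(V_σ)` + the central torus; the socket «B5a-E» of TABLE X rows 11 ∕ 13)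

Family `hodge`, layer `Literature/AlgebraicGeometry/HodgeTheory`, namespace `Literature.AlgebraicGeometry.HodgeTheory`.
THEOREMS ONLY: no definition, no named fact, no `sorry` (D-0026). Cell `pub-hodgeav-hg6` (req-37 (A) Q2b), seat eng-3 g3,
brick **B5a-E, part 2** (design memo `HOME/jobs/WEIL-EK-eng3g3/DESIGN.md`; part 1 = `WeilTypeCMFieldSlotsHodgeClassesOfLie`,
the `E = K` case = `WeilTypeSixfoldHodgeGroupSUOfLie`). HONEST FRAMING: HC ∕ HC_AV (stmt-1333) ∕ HC_CM (stmt-3052) ∕ H2 NOT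
proved; the Lie hypothesis `hSU` («every operator commuting with `φ_ℂ` (generator of `K`) and `φ_{E,ℂ}` (generator of `E`),
`ψ_ℂ`-skew and with trace `0` on `W_K = ker(φ_ℂ − i√d)` lies in `Lie Hg(H¹A) ⊗ ℂ`» — the row-11∕13 analogue of brick B4′,
NOT a tree theorem) is DISPLAYED on every theorem, never discharged.

## The statement and its place

The census files of TABLE X rows 11 ∕ 13 (`SixfoldTableXCensusWeilCMGeneralRows` L16, `…EndField` L16b) display the
GROUP-LEVEL hypothesis `hG : ∀ u ∈ S(A)(h)(ℂ) = unitaryCentralizerGroup A h, det(u | W_K) = 1 → u ∈ Hg(A)(ℂ)|_{H¹}`; for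
`End⁰(A) = E ⊋ K` one has `S(A)(ℂ) = U_E(ℂ)`, so `hG` reads «`U_E ∩ SU_K ⊆ Hg|_{H¹}`» (the «general member»,
Moonen–Zarhin 1998 §4: `Z(Hdg) ⊂ U_E`, `Hdg ⊂ SU_K` since `W_K` is Hodge). §3 derives `hG` VERBATIM from `hSU` and the
CM data of `(A, E ∋ φ_E)` in the form of the tree's `AVSlots.isDivisorGenerated_of_hodgeLieC_cmField` (`finrank_ℚ End⁰(A) =
2|ι|`, a CM type `μ : ι → ℂ` of `φ_E^*`, multiplicities `n₀`, `dim A = |ι| n₀`) plus the `K`-compatibility «`μ` is the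
`K`-fibre»: `ker(φ_{E,ℂ} − μ k) ⊆ W_K`, `ker(φ_{E,ℂ} − μ̄ k) ⊆ W̄_K`.

## The argument (on the tree's Tannaka-free carrier)
§1 (word model) If the slices of a coefficient function are killed by the typed differential of every block family
`(X_k)_k` with `∑_k tr X_k = 0` (part 1), then they are FIXED by the typed group family of every block family `(M_k)_k`
with `∏_k det M_k = 1`: write `M_k = t_k M_k'`, `det M_k' = 1`, `∏_k t_k = 1` (`n₀`-th roots in `ℂ`); the `M_k'` act
trivially colour by colour (`ClassicalInvariants.wordRepAt_mixedGrpFamilyAt_eq_self_of_forall_trace_of_det_eq_one`: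
`SL_{n₀}` is generated by transvections and its determinant-one torus), and the scalar family `t_{k(q)}^{±1}` acts on a
slice by `∏_k t_k^{a_k − b_k}` (`a_k`, `b_k` = numbers of type-`0` ∕ type-`1` positions of colour `k`), `= (∏_k t_k)^m = 1`
because the central differentials `(c_k · 1)_k`, `∑ c_k = 0`, kill the slice, forcing `a_k − b_k` to be independent of `k`.
§2 For `v₀ ∈ GL(H¹(A;ℚ) ⊗ ℂ)` commuting with `φ_ℂ` and `φ_{E,ℂ}`, preserving `ψ_ℂ`, with `det(v₀|_{W_K}) = 1`: its blocks
in adapted `ψ_ℂ`-dual coloured letters are `(M_k, (M_k⁻¹)ᵀ)` with `∏ det M_k = det(v₀|W_K) = 1`, so `⋀•(v^{⊕(a+1)})`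
fixes every Hodge class of every power (B5a §2 `diagPowExterior_wordEval_avLetters_eq_wordEval_colourChangeAt`) and the
transport `v` of `v₀` lies in `Hg(A)(ℂ)|_{H¹}` (`Milne1999.exteriorPullbackEquiv_mem_hodgeGroup_of_forall`).
§3 THE SOCKET, by the `u = v` trick of B5a §4: for `u ∈ S(A)(h)(ℂ)` with `det(u | W_K) = 1` build `v` from the blocks of
`u` on `W_K`; `v ∈ Hg|_{H¹} ≤ S(A)(h)`; `u`, `v` preserve `Q_h` and agree on `W_K`, and `W̄_K` is `Q_h`-isotropic
(`φ^*` a `d`-similitude) with `Q_h` non-degenerate, so `u = v`.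

IN PRINT? Method: Deligne I §3, Goodman–Wallach Thm. 2.2.7 (2), Gordon §6 (proof of Thm. 6.3.3, pp. 18–19); the statement
as a socket for sixfolds with `End⁰ = E ⊋ K` is not in print (memo §(iii): presearch null) — RECORD-class.

## References
* [Deligne1982HodgeCycles] P. Deligne, LNM 900 (1982), I §3 Prop. 3.4, 3.6, §4 (p. 30).
* [MoonenZarhin1998WeilClasses] B. Moonen, Yu. Zarhin, J. reine angew. Math. 496 (1998), §4 Remark (1).
* [MoonenZarhin1999LowDim] B. Moonen, Yu. Zarhin, Math. Ann. 315 (1999), §1 (1.8), §2 (2.3).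
* [GoodmanWallachGTM255] R. Goodman, N. R. Wallach, GTM 255 (2009), Lemma 2.2.1, Thm. 2.2.2, Thm. 2.2.7 (2), §4.1.1.
* [Milne1999LefschetzClasses] J. S. Milne, Duke Math. J. 96 (1999), §1 pp. 643–644, §4 p. 659.
* [Gordon1997] B. B. Gordon, arXiv:alg-geom/9709030, §6 pp. 18–19.
* [vanGeemen1994HodgeAV] B. van Geemen, LNM 1594 (1994), 6.9, Lemma 6.10.
-/

noncomputable section

open scoped TensorProduct
open scoped Matrix
open CategoryTheory Module

namespace Literature.AlgebraicGeometry.HodgeTheory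

open Literature.AlgebraicTopology.SingularHomology
open Literature.AlgebraicGeometry.Motives (IsSmoothProjective AbelianVariety bettiCohomology
  ofRatClassBaseChange ofRatClassBaseChange_tmul HodgeTensorFacts hodgeTensorFacts_holds)
open Literature.AlgebraicGeometry.Motives.HodgeStructure
open Literature.RepresentationTheory.GeneralLinear
open Literature.RepresentationTheory.ClassicalInvariants
open Literature.NumberTheory.DiophantineGeometry
open Literature.AlgebraicGeometry.VanGeemen1994 (pullbackOne hodgeGroupOne mem_hodgeGroupOne_iff hodgeClassSpan
  detOnEigenspace)
open Literature.AlgebraicGeometry.Milne1999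
open Literature.AlgebraicGeometry.ComplexMultiplication (bettiRep bettiRep_of)

/-! ### §1 Word model: traceless block families kill ⟹ determinant-one block families fix -/

section WordModel

variable {ι J : Type*} [Fintype ι] [DecidableEq ι] {n₀ dd : ℕ}

/-- The two elements of `Fin 2`. [folklore] -/
private theorem fin2_cases₃ (r : Fin 2) : r = 0 ∨ r = 1 := by
  fin_cases r <;> simp

/-- Bilinear expansion on two finite combinations: `B(∑ aᵣ eᵣ, ∑ bₛ fₛ) = ∑ᵣ ∑ₛ aᵣ bₛ B(eᵣ, fₛ)`. [folklore] -/
private theorem bilin_apply_sum_smul_sum_smul' {K V W : Type*} [Field K] [AddCommGroup V] [Module K V] [AddCommGroup W]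
    [Module K W] {L : Type*} [Fintype L] (B : V →ₗ[K] V →ₗ[K] W) (a b : L → K) (e f : L → V) :
    B (∑ r, a r • e r) (∑ s, b s • f s) = ∑ r, ∑ s, (a r * b s) • B (e r) (f s) := by
  rw [LinearMap.map_sum₂]
  refine Finset.sum_congr rfl fun r _ => ?_
  rw [LinearMap.map_smul₂, map_sum, Finset.smul_sum]
  refine Finset.sum_congr rfl fun s' _ => ?_
  rw [map_smul, smul_smul]

/-- **`n₀`-th roots with product one.** For `D : ι → ℂ` with `∏_k D k = 1` and `n₀ > 0` there are `t_k ≠ 0` with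
`t_k^{n₀} = D k` and `∏_k t_k = 1` (roots in the algebraically closed field `ℂ`, the last one adjusted). [folklore] -/
private theorem exists_roots_prod_eq_one (hn₀ : 0 < n₀) (D : ι → ℂ) (hD : ∀ k, D k ≠ 0) (hprod : ∏ k, D k = 1) :
    ∃ t : ι → ℂ, (∀ k, t k ≠ 0) ∧ (∀ k, t k ^ n₀ = D k) ∧ ∏ k, t k = 1 := by
  classical
  rcases isEmpty_or_nonempty ι with hι | ⟨⟨k₀⟩⟩
  · exact ⟨fun _ => 1, fun k => isEmptyElim k, fun k => isEmptyElim k, by simp⟩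
  have hroot : ∀ k, ∃ z : ℂ, z ^ n₀ = D k := fun k => IsAlgClosed.exists_pow_nat_eq (D k) hn₀
  choose r hr using hroot
  have hr0 : ∀ k, r k ≠ 0 := fun k h => hD k (by rw [← hr k, h, zero_pow hn₀.ne'])
  set P := ∏ k ∈ Finset.univ.erase k₀, r k with hP
  have hP0 : P ≠ 0 := Finset.prod_ne_zero_iff.2 fun k _ => hr0 k
  refine ⟨Function.update r k₀ P⁻¹, fun k => ?_, fun k => ?_, ?_⟩
  · by_cases hk : k = k₀
    · subst hk; rw [Function.update_self]; exact inv_ne_zero hP0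
    · rw [Function.update_of_ne hk]; exact hr0 k
  · by_cases hk : k = k₀
    · subst hk
      rw [Function.update_self, inv_pow, hP, ← Finset.prod_pow]
      simp_rw [hr]
      have h1 : (∏ k ∈ Finset.univ.erase k, D k) * D k = 1 := by
        rw [Finset.prod_erase_mul _ _ (Finset.mem_univ k), hprod]
      exact (eq_inv_of_mul_eq_one_right h1).symm
    · rw [Function.update_of_ne hk]; exact hr k
  · rw [← Finset.mul_prod_erase _ _ (Finset.mem_univ k₀), Function.update_self]
    have h2 : ∏ k ∈ Finset.univ.erase k₀, Function.update r k₀ P⁻¹ k = P :=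
      Finset.prod_congr rfl fun k hk => by rw [Function.update_of_ne (Finset.ne_of_mem_erase hk)]
    rw [h2, inv_mul_cancel₀ hP0]

/-- **Traceless block families kill ⟹ determinant-one block families fix** (the word-model core of the socket). Let `c`
be a function on slot-colour-type words with letters `Fin n₀` (`n₀ > 0`) such that for every slot-colour-type word `U` and
every family `(X_k)_k` with `∑_k tr X_k = 0` the typed differential (`X_k` at the type-`0` positions of colour `k`, `−X_kᵀ` at
the type-`1` positions of colour `k`) kills the slice `c(U, −)`. Then for every family `(M_k)_k` with `∏_k det M_k = 1` and
every `U`, the typed GROUP family (`M_k` ∕ `(M_k⁻¹)ᵀ`) fixes the slice: `M_k = t_k M_k'` with `det M_k' = 1`, `∏ t_k = 1`;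
the `M_k'` fix it colour by colour (`wordRepAt_mixedGrpFamilyAt_eq_self_of_forall_trace_of_det_eq_one`), the scalar family
`t^{±1}` multiplies it by `∏_k t_k^{a_k − b_k} = (∏ t_k)^m = 1` (the central differentials force equal position weights).
[cite: GoodmanWallachGTM255, Thm. 2.2.7 (2), Thm. 2.2.2 and §4.1.1] -/
theorem wordRepAt_blockFamily_wordSlice_eq_self (hn₀ : 0 < n₀)
    {c : (Fin dd → (J × (ι × Fin 2)) × Fin n₀) → ℂ}
    (hc : ∀ (U : Fin dd → J × (ι × Fin 2)) (Xf : ι → Matrix (Fin n₀) (Fin n₀) ℂ), (∑ k, (Xf k).trace) = 0 →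
      wordDerAt ℂ (fun t => if (U t).2.2 = 0 then Xf (U t).2.1 else -(Xf (U t).2.1)ᵀ) (wordSlice c U) = 0)
    (M : ι → Matrix (Fin n₀) (Fin n₀) ℂ) (hM : ∏ k, (M k).det = 1) (U : Fin dd → J × (ι × Fin 2)) :
    wordRepAt ℂ (fun q => if (U q).2.2 = 0 then M (U q).2.1 else ((M (U q).2.1)⁻¹)ᵀ) (wordSlice c U) = wordSlice c U := by
  classical
  have hMd : ∀ k, (M k).det ≠ 0 := fun k hk => by
    rw [Finset.prod_eq_zero (Finset.mem_univ k) hk] at hM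
    exact zero_ne_one hM
  obtain ⟨t, ht0, htn, htprod⟩ := exists_roots_prod_eq_one hn₀ (fun k => (M k).det) hMd hM
  -- the determinant-one parts
  set M' : ι → Matrix (Fin n₀) (Fin n₀) ℂ := fun k => (t k)⁻¹ • M k with hM'
  have hM'det : ∀ k, (M' k).det = 1 := fun k => by
    rw [hM', Matrix.det_smul, Fintype.card_fin, inv_pow, htn, inv_mul_cancel₀ (hMd k)]
  have hMeq : ∀ k, M k = t k • M' k := fun k => by rw [hM', smul_smul, mul_inv_cancel₀ (ht0 k), one_smul]
  have hM'unit : ∀ k, IsUnit (M' k).det := fun k => by rw [hM'det]; exact isUnit_one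
  have hMinvT : ∀ k, ((M k)⁻¹)ᵀ = (t k)⁻¹ • ((M' k)⁻¹)ᵀ := fun k => by
    have hinv : (M k)⁻¹ = (t k)⁻¹ • (M' k)⁻¹ := by
      refine Matrix.inv_eq_left_inv ?_
      rw [hMeq, Matrix.smul_mul, Matrix.mul_smul, smul_smul, Matrix.nonsing_inv_mul _ (hM'unit k),
        inv_mul_cancel₀ (ht0 k), one_smul]
    rw [hinv, Matrix.transpose_smul]
  -- colours and types of the positions
  set col : Fin dd → ι := fun q => (U q).2.1 with hcol
  set ty : Fin dd → Bool := fun q => decide ((U q).2.2 = 0) with hty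
  -- the Lie hypothesis at one colour, in the `mixedLieFamilyAt` format
  have hcAt : ∀ (k : ι) (X : Matrix (Fin n₀) (Fin n₀) ℂ), X.trace = 0 →
      wordDerAt ℂ (mixedLieFamilyAt col ty k X) (wordSlice c U) = 0 := by
    intro k X hX
    have hfam : mixedLieFamilyAt col ty k X =
        fun q => if (U q).2.2 = 0 then (fun k' => if k' = k then X else 0) (U q).2.1
          else -((fun k' => if k' = k then X else 0) (U q).2.1)ᵀ := by
      funext q
      by_cases hq : (U q).2.1 = k
      · rw [mixedLieFamilyAt_of_eq ty X (show col q = k from hq)]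
        simp only [hq, if_true, mixedLieFamily, hty, decide_eq_true_eq]
      · rw [mixedLieFamilyAt_of_ne ty X (show col q ≠ k from hq)]
        simp only [hq, if_false, Matrix.transpose_zero, neg_zero, ite_self]
    rw [hfam]
    refine hc U (fun k' => if k' = k then X else 0) ?_
    rw [Finset.sum_eq_single k]
    · simpa using hX
    · intro k' _ hk'; simp [hk']
    · intro h; exact absurd (Finset.mem_univ k) h
  -- the `SL` parts fix the slice, colour by colour
  have hSL : ∀ S : Finset ι,
      wordRepAt ℂ (fun q => if col q ∈ S then mixedGrpFamily ty (M' (col q)) q else 1) (wordSlice c U) = wordSlice c U := by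
    intro S
    induction S using Finset.induction_on with
    | empty =>
      have h1 : (fun q => if col q ∈ (∅ : Finset ι) then mixedGrpFamily ty (M' (col q)) q else 1) =
          (1 : Fin dd → Matrix (Fin n₀) (Fin n₀) ℂ) := by
        funext q; rw [if_neg (Finset.notMem_empty _), Pi.one_apply]
      rw [h1, wordRepAt_one]
    | insert k S hkS ih =>
      have hfam : (fun q => if col q ∈ insert k S then mixedGrpFamily ty (M' (col q)) q else 1) =
          mixedGrpFamilyAt col ty k (M' k) * fun q => if col q ∈ S then mixedGrpFamily ty (M' (col q)) q else 1 := by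
        funext q
        rw [Pi.mul_apply]
        by_cases hqk : col q = k
        · rw [mixedGrpFamilyAt_of_eq ty _ hqk, hqk, if_pos (Finset.mem_insert_self _ _), if_neg hkS, mul_one]
        · rw [mixedGrpFamilyAt_of_ne ty _ hqk, one_mul]
          by_cases hqS : col q ∈ S
          · rw [if_pos (Finset.mem_insert_of_mem hqS), if_pos hqS]
          · rw [if_neg hqS, if_neg (by rw [Finset.mem_insert]; push Not; exact ⟨hqk, hqS⟩)]
      rw [hfam, wordRepAt_mul, ih]
      exact wordRepAt_mixedGrpFamilyAt_eq_self_of_forall_trace_of_det_eq_one col ty k (hcAt k) (hM'det k)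
  -- the scalar family
  set s : Fin dd → ℂ := fun q => if (U q).2.2 = 0 then t (U q).2.1 else (t (U q).2.1)⁻¹ with hs
  have hdecomp : (fun q => if (U q).2.2 = 0 then M (U q).2.1 else ((M (U q).2.1)⁻¹)ᵀ) =
      (fun q => s q • (1 : Matrix (Fin n₀) (Fin n₀) ℂ)) *
        fun q => if col q ∈ (Finset.univ : Finset ι) then mixedGrpFamily ty (M' (col q)) q else 1 := by
    funext q
    rw [Pi.mul_apply, if_pos (Finset.mem_univ _), Matrix.smul_mul, Matrix.one_mul]
    by_cases hq : (U q).2.2 = 0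
    · rw [if_pos hq, mixedGrpFamily_of_eq_true _ (by simp [hty, hq]), hMeq]
      simp [hs, hq, hcol]
    · rw [if_neg hq, mixedGrpFamily_of_eq_false _ (by simp [hty, hq]), hMinvT]
      simp [hs, hq, hcol]
  rw [hdecomp, wordRepAt_mul, hSL]
  -- the scalar family acts by `∏_q s q = ∏_k t_k^{a_k − b_k} = 1`
  by_cases hzero : wordSlice c U = 0
  · rw [hzero, map_zero]
  funext w
  rw [wordRepAt_smul_one_family_apply]
  -- position counts per colour
  have hcount : ∀ k k' : ι,
      (((Finset.univ.filter fun q => col q = k ∧ ty q = true).card : ℤ) -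
        ((Finset.univ.filter fun q => col q = k ∧ ty q = false).card : ℤ)) =
      (((Finset.univ.filter fun q => col q = k' ∧ ty q = true).card : ℤ) -
        ((Finset.univ.filter fun q => col q = k' ∧ ty q = false).card : ℤ)) := by
    intro k k'
    by_cases hkk : k = k'
    · rw [hkk]
    -- the central family `(δ_k − δ_k') · 1` kills the slice
    set Xf : ι → Matrix (Fin n₀) (Fin n₀) ℂ := fun j =>
      Matrix.diagonal fun _ : Fin n₀ => (if j = k then (1 : ℂ) else 0) - (if j = k' then (1 : ℂ) else 0) with hXf
    have hδ : ∀ a : ι, (∑ j, (if j = a then (1 : ℂ) else 0)) = 1 := fun a => by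
      rw [Finset.sum_eq_single a, if_pos rfl]
      · intro j _ hj; exact if_neg hj
      · intro h; exact absurd (Finset.mem_univ a) h
    have htr : (∑ j, (Xf j).trace) = 0 := by
      have h1 : ∀ j, (Xf j).trace = ((if j = k then (1 : ℂ) else 0) - (if j = k' then (1 : ℂ) else 0)) * (n₀ : ℂ) := by
        intro j
        simp only [hXf, Matrix.trace_diagonal, Finset.sum_const, Finset.card_univ, Fintype.card_fin, nsmul_eq_mul]
        ring
      simp_rw [h1]
      rw [← Finset.sum_mul, Finset.sum_sub_distrib, hδ, hδ, sub_self, zero_mul]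
    have hkill := hc U Xf htr
    -- this family is diagonal with entries `±(δ_k − δ_k')(col q)`
    have hfam : (fun q => if (U q).2.2 = 0 then Xf (U q).2.1 else -(Xf (U q).2.1)ᵀ) =
        fun q => Matrix.diagonal fun _ : Fin n₀ =>
          (if ty q = true then (1 : ℂ) else -1) *
            ((if col q = k then (1 : ℂ) else 0) - (if col q = k' then (1 : ℂ) else 0)) := by
      funext q
      have hXq : Xf (col q) = Matrix.diagonal fun _ : Fin n₀ =>
          ((if col q = k then (1 : ℂ) else 0) - (if col q = k' then (1 : ℂ) else 0)) := rfl
      by_cases hq : (U q).2.2 = 0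
      · rw [if_pos hq, show (U q).2.1 = col q from rfl, hXq]
        congr 1; funext x; simp [hty, hq]
      · rw [if_neg hq, show (U q).2.1 = col q from rfl, hXq, Matrix.diagonal_transpose, Matrix.diagonal_neg]
        congr 1; funext x; simp [hty, hq]
    rw [hfam] at hkill
    obtain ⟨w₀, hw₀⟩ : ∃ w₀, wordSlice c U w₀ ≠ 0 := by
      by_contra hall
      push Not at hall
      exact hzero (funext hall)
    have hw := congr_fun hkill w₀
    rw [wordDerAt_diagonal_apply, Pi.zero_apply] at hw
    rcases mul_eq_zero.1 hw with hsum | hcw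
    · -- the sum is `(a_k − b_k) − (a_k' − b_k')`
      have hsplit : (∑ q : Fin dd, (if ty q = true then (1 : ℂ) else -1) *
          ((if col q = k then (1 : ℂ) else 0) - (if col q = k' then (1 : ℂ) else 0))) =
          ((((Finset.univ.filter fun q => col q = k ∧ ty q = true).card : ℂ) -
            ((Finset.univ.filter fun q => col q = k ∧ ty q = false).card : ℂ)) -
          (((Finset.univ.filter fun q => col q = k' ∧ ty q = true).card : ℂ) -
            ((Finset.univ.filter fun q => col q = k' ∧ ty q = false).card : ℂ))) := by
        have hpt : ∀ q : Fin dd, (if ty q = true then (1 : ℂ) else -1) *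
            ((if col q = k then (1 : ℂ) else 0) - (if col q = k' then (1 : ℂ) else 0)) =
            ((if col q = k ∧ ty q = true then (1 : ℂ) else 0) - (if col q = k ∧ ty q = false then (1 : ℂ) else 0)) -
            ((if col q = k' ∧ ty q = true then (1 : ℂ) else 0) - (if col q = k' ∧ ty q = false then (1 : ℂ) else 0)) := by
          intro q
          by_cases h1 : col q = k
          · by_cases h3 : ty q = true <;> simp [h1, h3, hkk]
          · by_cases h2 : col q = k'
            · by_cases h3 : ty q = true <;> simp [h2, h3, Ne.symm hkk]
            · by_cases h3 : ty q = true <;> simp [h1, h2, h3]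
        rw [Finset.sum_congr rfl fun q _ => hpt q]
        simp only [Finset.sum_sub_distrib, Finset.sum_boole]
      rw [hsplit] at hsum
      have hsum' := sub_eq_zero.1 hsum
      exact_mod_cast hsum'
    · exact absurd hcw hw₀
  -- hence `∏_q s q = 1`
  have hsprod : (∏ q, s q) = 1 := by
    rcases isEmpty_or_nonempty ι with hι | ⟨⟨k₀⟩⟩
    · rcases Nat.eq_zero_or_pos dd with hd | hd
      · subst hd; simp
      · exact isEmptyElim (col ⟨0, hd⟩)
    set m : ℤ := ((Finset.univ.filter fun q => col q = k₀ ∧ ty q = true).card : ℤ) -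
      ((Finset.univ.filter fun q => col q = k₀ ∧ ty q = false).card : ℤ) with hm
    have hfib : ∀ k, ∏ q ∈ Finset.univ.filter (fun q => col q = k), s q = t k ^ m := by
      intro k
      have hrew : ∀ q ∈ Finset.univ.filter (fun q => col q = k),
          s q = (if col q = k ∧ ty q = true then t k else 1) * (if col q = k ∧ ty q = false then (t k)⁻¹ else 1) := by
        intro q hq
        have hqk : (U q).2.1 = k := (Finset.mem_filter.1 hq).2
        by_cases h : (U q).2.2 = 0
        · simp [hs, h, hty, hqk, hcol]
        · simp [hs, h, hty, hqk, hcol]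
      rw [Finset.prod_congr rfl hrew, Finset.prod_mul_distrib, Finset.prod_ite, Finset.prod_const_one, mul_one,
        Finset.prod_const, Finset.prod_ite, Finset.prod_const_one, mul_one, Finset.prod_const, Finset.filter_filter,
        Finset.filter_filter]
      have hA : (Finset.univ.filter fun q => col q = k ∧ (col q = k ∧ ty q = true)) =
          Finset.univ.filter fun q => col q = k ∧ ty q = true := by
        ext q; simp
      have hB : (Finset.univ.filter fun q => col q = k ∧ (col q = k ∧ ty q = false)) =
          Finset.univ.filter fun q => col q = k ∧ ty q = false := by
        ext q; simp
      rw [hA, hB, hm, ← hcount k k₀, zpow_sub₀ (ht0 k), zpow_natCast, zpow_natCast, inv_pow, div_eq_mul_inv]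
    rw [← Finset.prod_fiberwise Finset.univ col s, Finset.prod_congr rfl fun k _ => hfib k, Finset.prod_zpow, htprod,
      one_zpow]
  rw [hsprod, one_mul]

end WordModel

/-! ### §2 «`Lie Hg ⊗ ℂ ⊇ 𝔲_E ∩ 𝔰𝔲_K`» ⟹ every `E_ℂ`-commuting `ψ_ℂ`-isometry of determinant one on `W_K` lies in `Hg(A)(ℂ)|_{H¹}` -/

section UEleHg

variable {A : AbelianVariety ℂ} {φ : A ⟶ A} {n d : ℕ} {ι : Type} [Fintype ι] [DecidableEq ι]

/-- The two elements of `Fin 2`. [folklore] -/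
private theorem fin2_cases₄ (r : Fin 2) : r = 0 ∨ r = 1 := by
  fin_cases r <;> simp

/-- `End_Hdg = ℚ[φ_E^*]` ⟹ every pull-back on `H¹(A(ℂ); ℂ)` is a complex polynomial in `φ_E^*`, hence commutes with every
automorphism commuting with `φ_E^*`. [cite: Milne1999LefschetzClasses, §1 pp. 642–644] [cite: DeligneMilne1982Tannakian, §6 Thm. 6.20] -/
theorem mem_centralizerGroup_of_comm_pullbackOne_of_endAlg_eq_polynomial {φE : A ⟶ A} {m : ℕ}
    (hEφ : ∀ a ∈ (BettiUniverse.hodge exists_isReal_hodgeModel_holds (AbelianVariety.isSmoothProjective_holds (A := A)) 1).endAlg,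
      ∃ q : Fin m → ℚ, a = ∑ k, q k • (bettiCohomology.map φE.hom.hom.hom 1).hom ^ (k : ℕ))
    {u : complexBetti A.X 1 ≃ₗ[ℂ] complexBetti A.X 1} (hu : ∀ z, u (pullbackOne A φE z) = pullbackOne A φE (u z)) :
    u ∈ centralizerGroup A := by
  rw [mem_centralizerGroup_iff]
  intro w z
  have hX : IsSmoothProjective A.dim A.X := AbelianVariety.isSmoothProjective_holds
  have hwE : (bettiCohomology.map w.hom.hom.hom 1).hom ∈
      (BettiUniverse.hodge exists_isReal_hodgeModel_holds (AbelianVariety.isSmoothProjective_holds (A := A)) 1).endAlg := by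
    have h := unop_bettiRep_mem_endAlg exists_isReal_hodgeModel_holds hodgePQ_independent_of_hodgeModel_holds
      (AbelianVariety.endAlgebra.of A w)
    rwa [bettiRep_of, MulOpposite.unop_op] at h
  obtain ⟨q, hq⟩ := hEφ _ hwE
  set ρ := ofRatClassBaseChangeEquiv hX 1 with hρ
  have hρw : ∀ y, ρ (((bettiCohomology.map w.hom.hom.hom 1).hom).baseChange ℂ y) = pullbackOne A w (ρ y) := fun y => by
    rw [hρ, ofRatClassBaseChangeEquiv_apply, ofRatClassBaseChangeEquiv_apply, ofRatClassBaseChange_baseChange_bettiMapHom]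
  have hρφE : ∀ y, ρ (((bettiCohomology.map φE.hom.hom.hom 1).hom).baseChange ℂ y) = pullbackOne A φE (ρ y) :=
    fun y => by
    rw [hρ, ofRatClassBaseChangeEquiv_apply, ofRatClassBaseChangeEquiv_apply, ofRatClassBaseChange_baseChange_bettiMapHom]
  have hρpow : ∀ (k : ℕ) y, ρ ((((bettiCohomology.map φE.hom.hom.hom 1).hom).baseChange ℂ ^ k) y) =
      (pullbackOne A φE ^ k) (ρ y) := by
    intro k
    induction k with
    | zero => intro y; rfl
    | succ k ih => intro y; rw [pow_succ, pow_succ, Module.End.mul_apply, Module.End.mul_apply, ih, hρφE]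
  -- `u` commutes with every power of `φ_E^*`
  have hupow : ∀ k : ℕ, ∀ z, u ((pullbackOne A φE ^ k) z) = (pullbackOne A φE ^ k) (u z) := by
    intro k
    induction k with
    | zero => intro z; rfl
    | succ k ih => intro z; rw [pow_succ, Module.End.mul_apply, Module.End.mul_apply, ih, hu]
  -- `w^* = ∑ q_k (φ_E^*)^k`
  have hsum : ∀ z', pullbackOne A w z' = ∑ k, ((q k : ℚ) : ℂ) • (pullbackOne A φE ^ (k : ℕ)) z' := by
    intro z'
    rw [← ρ.apply_symm_apply z', ← hρw, hq, BettiUniverse.baseChange_sum_smul_apply, map_sum]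
    refine Finset.sum_congr rfl fun k _ => ?_
    rw [map_smul, LinearMap.baseChange_pow, hρpow]
  rw [hsum, hsum, map_sum]
  exact Finset.sum_congr rfl fun k _ => by rw [map_smul, hupow]

open scoped Classical in
/-- **`U_E(ℂ) ∩ SU_K ⊆ Hg` FROM THE LIE STATEMENT** (Weil type with `End⁰ = E ⊋ K`). Let `(A, φ)` be of Weil type `(n, d)`,
`φ_E ∈ End(A)` with CM data in the form of the tree's `AVSlots.isDivisorGenerated_of_hodgeLieC_cmField` — `finrank_ℚ End⁰(A)
= 2|ι|`, a CM type `μ : ι → ℂ` of `φ_E^*` (injective, no `μ k'` conjugate to a `μ k`), multiplicities `n₀ > 0` with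
`eigenMultiplicity A φ_E (μ k) + eigenMultiplicity A φ_E (μ̄ k) = n₀` and `dim A = |ι| n₀` — which is the `K`-FIBRE of
`W_K = ker(φ^*_ℂ − i√d)`: `ker(φ_{E,ℂ} − μ k) ⊆ W_K`, `ker(φ_{E,ℂ} − μ̄ k) ⊆ W̄_K`; `ψ` a polarization of `H¹(A(ℂ); ℚ)` with the
displayed Lie hypothesis `hSU`. Then every automorphism `v₀` of `H¹(A(ℂ); ℚ) ⊗ ℂ` commuting with `φ_ℂ` and `φ_{E,ℂ}`, preserving
`ψ_ℂ` and with `det(v₀ | W_K) = 1` — an element of `U_E(ℂ) ∩ SU_K` —, transported to `H¹(A(ℂ); ℂ)`, lies in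
`Hg(A)(ℂ)|_{H¹} = hodgeGroupOne (dim A) A.X`. [cite: Deligne1982HodgeCycles, I §3 Prop. 3.4 and §4 (p. 30)]
[cite: GoodmanWallachGTM255, Thm. 2.2.2 and Thm. 2.2.7 (2)] [cite: MoonenZarhin1998WeilClasses, §4 Remark (1)] -/
theorem IsWeilType.trans_mem_hodgeGroupOne_of_cmField_of_det_eq_one [HodgeTensorFacts.{0, 0}]
    (hW : IsWeilType A φ n d) (φE : A ⟶ A) (hEcard : Module.finrank ℚ A.endAlgebra = 2 * Fintype.card ι)
    (μ : ι → ℂ) (hinj : Function.Injective μ) (hdist : ∀ k k', μ k' ≠ starRingEnd ℂ (μ k)) {n₀ : ℕ} (hn₀ : 0 < n₀)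
    (hmult : ∀ k, eigenMultiplicity A φE (μ k) + eigenMultiplicity A φE (starRingEnd ℂ (μ k)) = n₀)
    (hdim : A.dim = Fintype.card ι * n₀)
    (hKE : ∀ k, Module.End.eigenspace (((bettiCohomology.map φE.hom.hom.hom 1).hom).baseChange ℂ) (μ k) ≤
      Module.End.eigenspace (((bettiCohomology.map φ.hom.hom.hom 1).hom).baseChange ℂ) (Complex.I * (Real.sqrt d : ℂ)))
    (hKE' : ∀ k, Module.End.eigenspace (((bettiCohomology.map φE.hom.hom.hom 1).hom).baseChange ℂ) (starRingEnd ℂ (μ k)) ≤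
      Module.End.eigenspace (((bettiCohomology.map φ.hom.hom.hom 1).hom).baseChange ℂ) (-(Complex.I * (Real.sqrt d : ℂ))))
    (ψ : (BettiUniverse.hodge exists_isReal_hodgeModel_holds (AbelianVariety.isSmoothProjective_holds (A := A)) 1).Polarization)
    (hSU : ∀ (Y : Module.End ℂ (ℂ ⊗[ℚ] bettiCohomology A.X 1))
      (hYφ : Y * ((bettiCohomology.map φ.hom.hom.hom 1).hom).baseChange ℂ =
        ((bettiCohomology.map φ.hom.hom.hom 1).hom).baseChange ℂ * Y),
      Y * ((bettiCohomology.map φE.hom.hom.hom 1).hom).baseChange ℂ =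
        ((bettiCohomology.map φE.hom.hom.hom 1).hom).baseChange ℂ * Y →
      (∀ x y, ψ.form.baseChange ℂ (Y x) y + ψ.form.baseChange ℂ x (Y y) = 0) →
      LinearMap.trace ℂ _ (Y.restrict fun x (hx : x ∈ Module.End.eigenspace
          (((bettiCohomology.map φ.hom.hom.hom 1).hom).baseChange ℂ) (Complex.I * (Real.sqrt d : ℂ))) =>
        UnitaryTheta.apply_mem_eigenspace_of_commute hYφ hx) = 0 →
      Y ∈ (BettiUniverse.hodge exists_isReal_hodgeModel_holds (AbelianVariety.isSmoothProjective_holds (A := A)) 1).hodgeLieC)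
    {v₀ : (ℂ ⊗[ℚ] bettiCohomology A.X 1) ≃ₗ[ℂ] (ℂ ⊗[ℚ] bettiCohomology A.X 1)}
    (hvφ : (v₀ : Module.End ℂ (ℂ ⊗[ℚ] bettiCohomology A.X 1)) * ((bettiCohomology.map φ.hom.hom.hom 1).hom).baseChange ℂ =
      ((bettiCohomology.map φ.hom.hom.hom 1).hom).baseChange ℂ * (v₀ : Module.End ℂ (ℂ ⊗[ℚ] bettiCohomology A.X 1)))
    (hvφE : (v₀ : Module.End ℂ (ℂ ⊗[ℚ] bettiCohomology A.X 1)) * ((bettiCohomology.map φE.hom.hom.hom 1).hom).baseChange ℂ =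
      ((bettiCohomology.map φE.hom.hom.hom 1).hom).baseChange ℂ * (v₀ : Module.End ℂ (ℂ ⊗[ℚ] bettiCohomology A.X 1)))
    (hvψ : ∀ x y, ψ.form.baseChange ℂ (v₀ x) (v₀ y) = ψ.form.baseChange ℂ x y)
    (hdet : LinearMap.det ((v₀ : Module.End ℂ (ℂ ⊗[ℚ] bettiCohomology A.X 1)).restrict
      fun x (hx : x ∈ Module.End.eigenspace (((bettiCohomology.map φ.hom.hom.hom 1).hom).baseChange ℂ)
        (Complex.I * (Real.sqrt d : ℂ))) => UnitaryTheta.apply_mem_eigenspace_of_commute hvφ hx) = 1) :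
    (ofRatClassBaseChangeEquiv (AbelianVariety.isSmoothProjective_holds (A := A)) 1).symm.trans
        (v₀.trans (ofRatClassBaseChangeEquiv (AbelianVariety.isSmoothProjective_holds (A := A)) 1)) ∈
      hodgeGroupOne A.dim A.X := by
  classical
  -- the setting
  have hHD : exists_isReal_hodgeModel := exists_isReal_hodgeModel_holds
  have hI : hodgePQ_independent_of_hodgeModel := hodgePQ_independent_of_hodgeModel_holds
  have hX : IsSmoothProjective A.dim A.X := AbelianVariety.isSmoothProjective_holds
  haveI : Module.Finite ℚ (bettiCohomology A.X 1) := finite_bettiCohomology_one A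
  have heff := BettiUniverse.hodge_isEffective hHD hX 1
  set φQ : Module.End ℚ (bettiCohomology A.X 1) := (bettiCohomology.map φ.hom.hom.hom 1).hom with hφQdef
  set φEQ : Module.End ℚ (bettiCohomology A.X 1) := (bettiCohomology.map φE.hom.hom.hom 1).hom with hφEQdef
  set μK : ℂ := Complex.I * (Real.sqrt d : ℂ) with hμKdef
  have hμK0 : μK ≠ 0 := mul_ne_zero Complex.I_ne_zero
    (Complex.ofReal_ne_zero.2 (Real.sqrt_ne_zero'.2 (Nat.cast_pos.2 hW.d_pos)))
  have hμKne : -μK ≠ μK := fun h' => hμK0 (by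
    have h2 : (2 : ℂ) * μK = 0 := by rw [two_mul]; nth_rw 1 [← h']; exact neg_add_cancel μK
    exact (mul_eq_zero.1 h2).resolve_left two_ne_zero)
  set ρ := ofRatClassBaseChangeEquiv hX 1 with hρ
  set v : complexBetti A.X 1 ≃ₗ[ℂ] complexBetti A.X 1 := ρ.symm.trans (v₀.trans ρ) with hvdef
  have hv_apply : ∀ z, v z = ρ (v₀ (ρ.symm z)) := fun z => rfl
  -- the CM data on `H¹(A(ℂ); ℚ)` (dictionary of `AVSlots.isDivisorGenerated_of_hodgeLieC_cmField`)
  have hφEE : φEQ ∈ (BettiUniverse.hodge hHD (AbelianVariety.isSmoothProjective_holds (A := A)) 1).endAlg := by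
    have h := unop_bettiRep_mem_endAlg hHD hI (AbelianVariety.endAlgebra.of A φE)
    rwa [bettiRep_of, MulOpposite.unop_op] at h
  have hVC : Module.finrank ℂ (ℂ ⊗[ℚ] bettiCohomology A.X 1) = Fintype.card (ι × Fin 2) * n₀ := by
    rw [Module.finrank_baseChange, finrank_bettiCohomology_one A, hdim, Fintype.card_prod, Fintype.card_fin]; ring
  set ev : ι × Fin 2 → ℂ := fun kt => if kt.2 = 0 then μ kt.1 else starRingEnd ℂ (μ kt.1) with hevdef
  have hev0 : ∀ k, ev (k, 0) = μ k := fun k => by simp [hevdef]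
  have hev1 : ∀ k, ev (k, 1) = starRingEnd ℂ (μ k) := fun k => by simp [hevdef]
  have hev : Function.Injective ev := by
    rintro ⟨k, t⟩ ⟨k', t'⟩ h
    rcases fin2_cases₄ t with rfl | rfl <;> rcases fin2_cases₄ t' with rfl | rfl
    · rw [hev0, hev0] at h; rw [hinj h]
    · rw [hev0, hev1] at h; exact absurd h (hdist k' k)
    · rw [hev1, hev0] at h; exact absurd h.symm (hdist k k')
    · rw [hev1, hev1] at h; rw [hinj ((starRingEnd ℂ).injective h)]
  have hgr := fun cc => CMTheta.finrank_eigenspace_eq_add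
    (BettiUniverse.hodge hHD (AbelianVariety.isSmoothProjective_holds (A := A)) 1) Nat.cast_one heff hφEE cc
  have h10 : ∀ cc, Module.finrank ℂ ↥(Module.End.eigenspace (φEQ.baseChange ℂ) cc ⊓
      (BettiUniverse.hodge hHD (AbelianVariety.isSmoothProjective_holds (A := A)) 1).piece 1 0) =
        eigenMultiplicity A φE cc := fun cc => by
    rw [hφEQdef, finrank_eigenspace_inf_piece_oneZero_eq_eigenMultiplicity hHD hI φE cc]
  have h01 : ∀ cc, Module.finrank ℂ ↥(Module.End.eigenspace (φEQ.baseChange ℂ) cc ⊓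
      (BettiUniverse.hodge hHD (AbelianVariety.isSmoothProjective_holds (A := A)) 1).piece 0 1) =
        eigenMultiplicity A φE (starRingEnd ℂ cc) := fun cc => by
    rw [hφEQdef, finrank_eigenspace_inf_piece_zeroOne_eq_eigenMultiplicity_conj hHD hI φE cc]
  have hfin : ∀ kt, Module.finrank ℂ ↥(Module.End.eigenspace (φEQ.baseChange ℂ) (ev kt)) = n₀ := by
    rintro ⟨k, t⟩
    rw [hgr, h10, h01]
    rcases fin2_cases₄ t with rfl | rfl
    · rw [hev0]; exact hmult k
    · rw [hev1, starRingEnd_self_apply, add_comm]; exact hmult k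
  have hWne : ∀ kt, Module.End.eigenspace (φEQ.baseChange ℂ) (ev kt) ≠ ⊥ := by
    intro kt hkt
    have h := hfin kt
    rw [hkt, finrank_bot] at h
    omega
  have hcard : Fintype.card (ι × Fin 2) = 2 * Fintype.card ι := by
    rw [Fintype.card_prod, Fintype.card_fin, mul_comm]
  set eι : ι × Fin 2 ≃ Fin (2 * Fintype.card ι) := Fintype.equivFinOfCardEq hcard with heιdef
  have hEφ := exists_eq_sum_smul_pow_bettiMapHom_fin hHD hI φE hEcard (ev ∘ eι.symm) (hev.comp eι.symm.injective)
    fun j => hWne (eι.symm j)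
  have hrank : ∀ k, Module.finrank ℂ ↥(Module.End.eigenspace (φEQ.baseChange ℂ) (μ k) ⊓
      (BettiUniverse.hodge hHD (AbelianVariety.isSmoothProjective_holds (A := A)) 1).piece 1 0) +
      Module.finrank ℂ ↥(Module.End.eigenspace (φEQ.baseChange ℂ) (μ k) ⊓
      (BettiUniverse.hodge hHD (AbelianVariety.isSmoothProjective_holds (A := A)) 1).piece 0 1) = n₀ := fun k => by
    rw [h10, h01]; exact hmult k
  have htop : (⨆ kt : ι × Fin 2, Module.End.eigenspace (φEQ.baseChange ℂ) (ev kt)) = ⊤ := by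
    have hind : iSupIndep fun kt => Module.End.eigenspace (φEQ.baseChange ℂ) (ev kt) :=
      (Module.End.eigenspaces_iSupIndep (φEQ.baseChange ℂ)).comp hev
    apply Submodule.eq_top_of_finrank_eq
    have h := Motives.finrank_biSup_eq_sum_of_iSupIndep hind Finset.univ
    have hs : (⨆ kt ∈ (Finset.univ : Finset (ι × Fin 2)), Module.End.eigenspace (φEQ.baseChange ℂ) (ev kt)) =
        ⨆ kt, Module.End.eigenspace (φEQ.baseChange ℂ) (ev kt) := by simp
    rw [hs] at h
    rw [h, hVC, Finset.sum_congr rfl fun kt _ => hfin kt, Finset.sum_const, Finset.card_univ, smul_eq_mul]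
  -- adapted dual coloured letters
  obtain ⟨cb, κ, hcbW, hcbW', hcb0, hcb1, hdual, hiso⟩ := CMTheta.exists_adaptedDualBasis
    (BettiUniverse.hodge hHD (AbelianVariety.isSmoothProjective_holds (A := A)) 1) Nat.cast_one heff ψ hφEE hEφ μ
    hinj hdist hrank htop
  have hKcb : ∀ k ℓ, cb ((k, 0), ℓ) ∈ Module.End.eigenspace (φQ.baseChange ℂ) μK := fun k ℓ => hKE k (hcbW k ℓ)
  have hKcb' : ∀ k ℓ, cb ((k, 1), ℓ) ∈ Module.End.eigenspace (φQ.baseChange ℂ) (-μK) := fun k ℓ => hKE' k (hcbW' k ℓ)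
  have hφEcb : ∀ (kt : ι × Fin 2) ℓ, φEQ.baseChange ℂ (cb (kt, ℓ)) = ev kt • cb (kt, ℓ) := by
    rintro ⟨k, t⟩ ℓ
    rcases fin2_cases₄ t with rfl | rfl
    · rw [hev0]; exact Module.End.mem_eigenspace_iff.1 (hcbW k ℓ)
    · rw [hev1]; exact Module.End.mem_eigenspace_iff.1 (hcbW' k ℓ)
  set evK : ι × Fin 2 → ℂ := fun kt => if kt.2 = 0 then μK else -μK with hevKdef
  have hφKcb : ∀ (kt : ι × Fin 2) ℓ, φQ.baseChange ℂ (cb (kt, ℓ)) = evK kt • cb (kt, ℓ) := by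
    rintro ⟨k, t⟩ ℓ
    rcases fin2_cases₄ t with rfl | rfl
    · simp only [hevKdef, if_pos rfl]; exact Module.End.mem_eigenspace_iff.1 (hKcb k ℓ)
    · simp only [hevKdef, if_neg one_ne_zero]; exact Module.End.mem_eigenspace_iff.1 (hKcb' k ℓ)
  -- the blocks `M k`, `N k` of `v₀` on `W_{μ k}`, `W_{μ̄ k}`
  have hvWk : ∀ kt, ∀ x ∈ Module.End.eigenspace (φEQ.baseChange ℂ) (ev kt),
      v₀ x ∈ Module.End.eigenspace (φEQ.baseChange ℂ) (ev kt) :=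
    fun kt x hx => UnitaryTheta.apply_mem_eigenspace_of_commute hvφE hx
  have hbk : ∀ kt : ι × Fin 2, ∃ bW : Module.Basis (Fin n₀) ℂ (Module.End.eigenspace (φEQ.baseChange ℂ) (ev kt)),
      ∀ ℓ, (bW ℓ : ℂ ⊗[ℚ] bettiCohomology A.X 1) = cb (kt, ℓ) := fun kt =>
    exists_basis_eigenspace_of_blocks cb hφEcb kt rfl fun τ hτ h => hτ (hev h)
  choose bk hbk using hbk
  set Gm : ι × Fin 2 → Matrix (Fin n₀) (Fin n₀) ℂ := fun kt =>
    Matrix.of fun r ℓ => (bk kt).repr ⟨v₀ (cb (kt, ℓ)), hvWk kt _ (by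
      rcases fin2_cases₄ kt.2 with h | h
      · have : kt = (kt.1, 0) := Prod.ext rfl h
        rw [this, hev0]; exact hcbW kt.1 ℓ
      · have : kt = (kt.1, 1) := Prod.ext rfl h
        rw [this, hev1]; exact hcbW' kt.1 ℓ)⟩ r with hGmdef
  have hv₀cb : ∀ (kt : ι × Fin 2) ℓ, v₀ (cb (kt, ℓ)) = ∑ r, Gm kt r ℓ • cb (kt, r) := by
    intro kt ℓ
    have hmem : cb (kt, ℓ) ∈ Module.End.eigenspace (φEQ.baseChange ℂ) (ev kt) :=
      Module.End.mem_eigenspace_iff.2 (hφEcb kt ℓ)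
    have hs := congrArg Subtype.val ((bk kt).sum_repr ⟨v₀ (cb (kt, ℓ)), hvWk kt _ hmem⟩)
    rw [Submodule.coe_sum] at hs
    change _ = v₀ (cb (kt, ℓ)) at hs
    rw [← hs]
    exact Finset.sum_congr rfl fun r _ => by rw [Submodule.coe_smul, hbk]; rfl
  set M : ι → Matrix (Fin n₀) (Fin n₀) ℂ := fun k => Gm (k, 0) with hMdef
  -- `(M k)ᵀ (N k) = 1`: the type-`1` block is `(M k⁻¹)ᵀ`
  set ψC := ψ.form.baseChange ℂ with hψC
  have hdual_same : ∀ k i j, ψC (cb ((k, 0), i)) (cb ((k, 1), j)) = if i = j then 1 else 0 := fun k i j => by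
    rw [hψC, hdual]; simp
  have hMN : ∀ k, (M k)ᵀ * Gm (k, 1) = 1 := by
    intro k
    ext i j
    have h1 := hvψ (cb ((k, 0), i)) (cb ((k, 1), j))
    rw [hv₀cb, hv₀cb, hdual_same, bilin_apply_sum_smul_sum_smul'] at h1
    have e1 : ∀ r : Fin n₀, ∑ s, (Gm (k, 0) r i * Gm (k, 1) s j) • ψC (cb ((k, 0), r)) (cb ((k, 1), s)) =
        M k r i * Gm (k, 1) r j := by
      intro r
      rw [Finset.sum_eq_single r]
      · rw [hdual_same, if_pos rfl, smul_eq_mul, mul_one]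
      · intro s _ hs; rw [hdual_same, if_neg (Ne.symm hs), smul_zero]
      · intro hr; exact absurd (Finset.mem_univ r) hr
    rw [Finset.sum_congr rfl fun r _ => e1 r] at h1
    rw [Matrix.mul_apply, Matrix.one_apply]
    simpa only [Matrix.transpose_apply] using h1
  have hNeq : ∀ k, Gm (k, 1) = ((M k)⁻¹)ᵀ := fun k => by
    rw [Matrix.transpose_nonsing_inv, Matrix.inv_eq_right_inv (hMN k)]
  have hGm : ∀ (kt : ι × Fin 2), Gm kt = if kt.2 = 0 then M kt.1 else ((M kt.1)⁻¹)ᵀ := by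
    rintro ⟨k, t⟩
    rcases fin2_cases₄ t with rfl | rfl
    · simp [hMdef]
    · rw [if_neg one_ne_zero]; exact hNeq k
  -- `det(v₀ | W_K) = ∏_k det (M k) = 1`: the type-`0` letters are a basis of `W_K`, indexed by `Fin n₀ × ι`
  set eW : Fin 2 × (Fin n₀ × ι) ≃ (ι × Fin 2) × Fin n₀ :=
    { toFun := fun x => ((x.2.2, x.1), x.2.1)
      invFun := fun y => (y.1.2, (y.2, y.1.1))
      left_inv := fun x => rfl
      right_inv := fun y => rfl } with heW
  set cbW : Module.Basis (Fin 2 × (Fin n₀ × ι)) ℂ (ℂ ⊗[ℚ] bettiCohomology A.X 1) := cb.reindex eW.symm with hcbWdef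
  have hcbW_apply : ∀ (t : Fin 2) (r : Fin n₀) (k : ι), cbW (t, (r, k)) = cb ((k, t), r) := fun t r k => by
    rw [hcbWdef, Module.Basis.reindex_apply, Equiv.symm_symm]
    rfl
  obtain ⟨bW, hbW⟩ := exists_basis_eigenspace_of_blocks cbW (f := φQ.baseChange ℂ) (ε := ![μK, -μK])
    (fun t rk => by
      obtain ⟨r, k⟩ := rk
      rw [hcbW_apply, hφKcb]
      rcases fin2_cases₄ t with rfl | rfl
      · simp [hevKdef]
      · simp [hevKdef])
    0 (μ := μK) (by simp) (fun t ht => by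
      rcases fin2_cases₄ t with rfl | rfl
      · exact absurd rfl ht
      · simpa using hμKne)
  have hbW' : ∀ rk : Fin n₀ × ι, (bW rk : ℂ ⊗[ℚ] bettiCohomology A.X 1) = cb ((rk.2, 0), rk.1) := fun rk => by
    rw [hbW, hcbW_apply]
  have hv₀W : ∀ rk : Fin n₀ × ι, (v₀ : Module.End ℂ (ℂ ⊗[ℚ] bettiCohomology A.X 1)) (cb ((rk.2, 0), rk.1)) =
      ∑ x : Fin n₀ × ι, Matrix.blockDiagonal M x rk • cb ((x.2, 0), x.1) := by
    rintro ⟨ℓ, k⟩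
    rw [LinearEquiv.coe_coe, hv₀cb, Fintype.sum_prod_type_right, Finset.sum_eq_single k]
    · exact Finset.sum_congr rfl fun r _ => by rw [Matrix.blockDiagonal_apply_eq]
    · intro k' _ hk'
      exact Finset.sum_eq_zero fun r _ => by rw [Matrix.blockDiagonal_apply_ne _ _ _ hk', zero_smul]
    · intro hk; exact absurd (Finset.mem_univ k) hk
  have hdetM : ∏ k, (M k).det = 1 := by
    rw [← Matrix.det_blockDiagonal, ← hdet, ← LinearMap.det_toMatrix bW,
      toMatrix_restrict_eq_of_apply_eq_sum' bW hbW' _ (Matrix.blockDiagonal M) hv₀W]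
  -- the letters in `H¹(A(ℂ); ℂ)` and the action of `v` on them
  set x : (ι × Fin 2) × Fin n₀ → complexBetti A.X 1 := fun tl =>
    ofRatClassBaseChange (Motives.ComplexPoints A.X) 1 (cb tl) with hxdef
  have hxρ : ∀ tl, x tl = ρ (cb tl) := fun tl => by rw [hxdef, hρ, ofRatClassBaseChangeEquiv_apply]
  have hvx : ∀ kt ℓ, v (x (kt, ℓ)) = ∑ r, Gm kt r ℓ • x (kt, r) := fun kt ℓ => by
    rw [hxρ, hv_apply, ρ.symm_apply_apply, hv₀cb, map_sum]
    exact Finset.sum_congr rfl fun r _ => by rw [map_smul, hxρ]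
  -- `v ∈ C(A) ⊗ ℂ`
  have hvφE' : ∀ z, v (pullbackOne A φE z) = pullbackOne A φE (v z) := fun z => by
    rw [hv_apply, hv_apply]
    have h1 : ρ.symm (pullbackOne A φE z) = φEQ.baseChange ℂ (ρ.symm z) := by
      apply ρ.injective
      rw [ρ.apply_symm_apply, hρ, ofRatClassBaseChangeEquiv_apply, hφEQdef, ofRatClassBaseChange_baseChange_bettiMapHom,
        ← ofRatClassBaseChangeEquiv_apply hX, LinearEquiv.apply_symm_apply]
    have h2 : v₀ (φEQ.baseChange ℂ (ρ.symm z)) = φEQ.baseChange ℂ (v₀ (ρ.symm z)) := by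
      have h3 := LinearMap.congr_fun hvφE (ρ.symm z)
      simpa only [Module.End.mul_apply, LinearEquiv.coe_coe] using h3
    rw [h1, h2, hρ, ofRatClassBaseChangeEquiv_apply, hφEQdef, ofRatClassBaseChange_baseChange_bettiMapHom,
      ← ofRatClassBaseChangeEquiv_apply hX]
  have hvC : v ∈ centralizerGroup A := mem_centralizerGroup_of_comm_pullbackOne_of_endAlg_eq_polynomial hEφ hvφE'
  -- `⋀•(v^{⊕(a+1)})` fixes every rational `(p,p)`-class of every power
  have key : ∀ (a p : ℕ) (c : complexBetti (A.powSucc a).X (2 * p)), IsRationalClass c →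
      IsOfHodgeType (A.powSucc a).dim (A.powSucc a).X (2 * p) p p c → diagPowExterior A v a (2 * p) c = c := by
    intro a p c hcQ hc
    rcases Nat.eq_zero_or_pos p with rfl | hp
    · obtain ⟨t, rfl⟩ := exists_eq_smul_one_of_isSmoothProjective
        (AbelianVariety.isSmoothProjective_holds (A := A.powSucc a)) ℂ c
      rw [map_smul]
      congr 1
      show diagPowExterior A v a 0 _ = _
      rw [diagPowExterior, exteriorPullbackEquiv_apply, exteriorPullback_one]
    · obtain ⟨cf, hcf, hkill⟩ := (AVSlots.powSucc A a).exists_suInvariant_coeff_of_hodgeLieC hHD hI ψ hμKne hSU μ cb κ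
        hcbW hcbW' hKcb hKcb' hcb0 hcb1 hdual hiso hp hcQ hc
      rw [← hcf, diagPowExterior_wordEval_avLetters_eq_wordEval_colourChangeAt hvC x Gm hvx a (2 * p) cf,
        colourChangeAt_eq_self_of_forall_wordSlice]
      intro U
      have hfamG : (fun q => Gm (U q).2) = fun q => if (U q).2.2 = 0 then M (U q).2.1 else ((M (U q).2.1)⁻¹)ᵀ :=
        funext fun q => hGm (U q).2
      rw [hfamG]
      exact wordRepAt_blockFamily_wordSlice_eq_self hn₀ hkill M hdetM U
  have hmem := exteriorPullbackEquiv_mem_hodgeGroup_of_forall key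
  exact mem_hodgeGroupOne_iff.2 ⟨_, hmem, exteriorPullbackEquiv_one_eq _ v⟩

end UEleHg

/-! ### §3 THE SOCKET: `S(A)(h)(ℂ) ∩ {det_{W_K} = 1} ⊆ Hg(A)(ℂ)|_{H¹}` for `End⁰ = E ⊋ K` — the displayed `hG` of TABLE X rows 11 ∕ 13 -/

section SocketE

variable {A : AbelianVariety ℂ} {φ : A ⟶ A} {n d : ℕ} {ι : Type} [Fintype ι] [DecidableEq ι]

/-- The two elements of `Fin 2`. [folklore] -/
private theorem fin2_cases₅ (r : Fin 2) : r = 0 ∨ r = 1 := by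
  fin_cases r <;> simp

open scoped Classical in
/-- **B5a-E — THE LIE-TO-GROUP PASSAGE FOR WEIL TYPE WITH `End⁰ = E ⊋ K` (socket `hG` of the TABLE X census files
`SixfoldTableXCensusWeilCMGeneralRows` ∕ `…EndField`, rows 11 ∕ 13).** Data: `(A, φ)` of Weil type `(n, d)`; `φ_E ∈ End(A)`
with the CM data of `AVSlots.isDivisorGenerated_of_hodgeLieC_cmField` (`finrank_ℚ End⁰(A) = 2|ι|`, CM type `μ` of `φ_E^*` =
the `K`-fibre of `W_K`, multiplicities `n₀ > 0`, `dim A = |ι| n₀`); `ψ` a polarization of `H¹(A(ℂ); ℚ)` with the DISPLAYED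
Lie hypothesis `hSU` («every operator commuting with `φ_ℂ` and `φ_{E,ℂ}`, `ψ_ℂ`-skew, with trace `0` on `W_K` lies in
`Lie Hg ⊗ ℂ`»); a class `h ∈ B¹(A) ⊗ ℂ` with `Q_h` non-degenerate and `φ^*` a `d`-similitude of `Q_h`. Then every
`u ∈ S(A)(h)(ℂ) = unitaryCentralizerGroup A h` with `det(u | W_K) = 1` lies in `Hg(A)(ℂ)|_{H¹}` — the binder `hG` of L16 ∕ L16b
VERBATIM. Proof (the `u = v` trick of B5a §4): `M_k` = the block of `u` on `W_{μ k} ⊆ W_K` in adapted coloured letters,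
`v = ⊕_k (M_k ⊕ (M_k⁻¹)ᵀ)` commutes with `φ_ℂ`, `φ_{E,ℂ}`, preserves `ψ_ℂ`, has `det(v|W_K) = ∏ det M_k = det(u|W_K) = 1`, so
`v ∈ Hg|_{H¹}` (§2) `≤ S(A)(h)`; `u`, `v` preserve `Q_h` and agree on `W_K`, `W̄_K` is `Q_h`-isotropic, `Q_h` is non-degenerate:
`u = v`. NOT proved here: `hSU` (the row-11∕13 Lie theorems), HC for any row.
[cite: Deligne1982HodgeCycles, I §3 Prop. 3.4 and 3.6] [cite: MoonenZarhin1998WeilClasses, §4 Remark (1)]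
[cite: Milne1999LefschetzClasses, §1 p. 644 and §4 p. 659] [cite: GoodmanWallachGTM255, Thm. 2.2.2 and Thm. 2.2.7 (2)] -/
theorem IsWeilType.mem_hodgeGroupOne_of_mem_unitaryCentralizerGroup_of_cmField_of_hodgeLieC [HodgeTensorFacts.{0, 0}]
    (hW : IsWeilType A φ n d) (φE : A ⟶ A) (hEcard : Module.finrank ℚ A.endAlgebra = 2 * Fintype.card ι)
    (μ : ι → ℂ) (hinj : Function.Injective μ) (hdist : ∀ k k', μ k' ≠ starRingEnd ℂ (μ k)) {n₀ : ℕ} (hn₀ : 0 < n₀)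
    (hmult : ∀ k, eigenMultiplicity A φE (μ k) + eigenMultiplicity A φE (starRingEnd ℂ (μ k)) = n₀)
    (hdim : A.dim = Fintype.card ι * n₀)
    (hKE : ∀ k, Module.End.eigenspace (((bettiCohomology.map φE.hom.hom.hom 1).hom).baseChange ℂ) (μ k) ≤
      Module.End.eigenspace (((bettiCohomology.map φ.hom.hom.hom 1).hom).baseChange ℂ) (Complex.I * (Real.sqrt d : ℂ)))
    (hKE' : ∀ k, Module.End.eigenspace (((bettiCohomology.map φE.hom.hom.hom 1).hom).baseChange ℂ) (starRingEnd ℂ (μ k)) ≤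
      Module.End.eigenspace (((bettiCohomology.map φ.hom.hom.hom 1).hom).baseChange ℂ) (-(Complex.I * (Real.sqrt d : ℂ))))
    (ψ : (BettiUniverse.hodge exists_isReal_hodgeModel_holds (AbelianVariety.isSmoothProjective_holds (A := A)) 1).Polarization)
    (hSU : ∀ (Y : Module.End ℂ (ℂ ⊗[ℚ] bettiCohomology A.X 1))
      (hYφ : Y * ((bettiCohomology.map φ.hom.hom.hom 1).hom).baseChange ℂ =
        ((bettiCohomology.map φ.hom.hom.hom 1).hom).baseChange ℂ * Y),
      Y * ((bettiCohomology.map φE.hom.hom.hom 1).hom).baseChange ℂ =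
        ((bettiCohomology.map φE.hom.hom.hom 1).hom).baseChange ℂ * Y →
      (∀ x y, ψ.form.baseChange ℂ (Y x) y + ψ.form.baseChange ℂ x (Y y) = 0) →
      LinearMap.trace ℂ _ (Y.restrict fun x (hx : x ∈ Module.End.eigenspace
          (((bettiCohomology.map φ.hom.hom.hom 1).hom).baseChange ℂ) (Complex.I * (Real.sqrt d : ℂ))) =>
        UnitaryTheta.apply_mem_eigenspace_of_commute hYφ hx) = 0 →
      Y ∈ (BettiUniverse.hodge exists_isReal_hodgeModel_holds (AbelianVariety.isSmoothProjective_holds (A := A)) 1).hodgeLieC)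
    {h : complexBetti A.X 2} (hh : h ∈ hodgeClassSpan A.dim A.X 1)
    (hnd : ∀ x : complexBetti A.X 1, (∀ y, Motives.polarizationPairingOne A.X h (A.dim - 1) x y = 0) → x = 0)
    (hφQ : ∀ x y, Motives.polarizationPairingOne A.X h (A.dim - 1) (pullbackOne A φ x) (pullbackOne A φ y) =
      (d : ℂ) • Motives.polarizationPairingOne A.X h (A.dim - 1) x y)
    (u : complexBetti A.X 1 ≃ₗ[ℂ] complexBetti A.X 1) (hu : u ∈ unitaryCentralizerGroup A h)
    (hdet : detOnEigenspace u (pullbackOne A φ) (fun x ↦ (mem_centralizerGroup_iff.1 hu.1) φ x)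
      (Complex.I * (Real.sqrt d : ℂ)) = 1) :
    u ∈ hodgeGroupOne A.dim A.X := by
  classical
  -- the setting
  have hHD : exists_isReal_hodgeModel := exists_isReal_hodgeModel_holds
  have hI : hodgePQ_independent_of_hodgeModel := hodgePQ_independent_of_hodgeModel_holds
  have hX : IsSmoothProjective A.dim A.X := AbelianVariety.isSmoothProjective_holds
  haveI : Module.Finite ℚ (bettiCohomology A.X 1) := finite_bettiCohomology_one A
  have heff := BettiUniverse.hodge_isEffective hHD hX 1
  set φQ : Module.End ℚ (bettiCohomology A.X 1) := (bettiCohomology.map φ.hom.hom.hom 1).hom with hφQdef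
  set φEQ : Module.End ℚ (bettiCohomology A.X 1) := (bettiCohomology.map φE.hom.hom.hom 1).hom with hφEQdef
  set μK : ℂ := Complex.I * (Real.sqrt d : ℂ) with hμKdef
  have hμK0 : μK ≠ 0 := mul_ne_zero Complex.I_ne_zero
    (Complex.ofReal_ne_zero.2 (Real.sqrt_ne_zero'.2 (Nat.cast_pos.2 hW.d_pos)))
  have hμKne : -μK ≠ μK := fun h' => hμK0 (by
    have h2 : (2 : ℂ) * μK = 0 := by rw [two_mul]; nth_rw 1 [← h']; exact neg_add_cancel μK
    exact (mul_eq_zero.1 h2).resolve_left two_ne_zero)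
  have hμK2 : μK * μK = -(d : ℂ) := by
    rw [hμKdef, mul_mul_mul_comm, Complex.I_mul_I, ← Complex.ofReal_mul, Real.mul_self_sqrt (Nat.cast_nonneg d),
      Complex.ofReal_natCast, neg_one_mul]
  set ρ := ofRatClassBaseChangeEquiv hX 1 with hρ
  set Q := Motives.polarizationPairingOne A.X h (A.dim - 1) with hQdef
  have hρφ : ∀ z, ρ (φQ.baseChange ℂ z) = pullbackOne A φ (ρ z) := fun z => by
    rw [hρ, ofRatClassBaseChangeEquiv_apply, ofRatClassBaseChangeEquiv_apply, hφQdef,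
      ofRatClassBaseChange_baseChange_bettiMapHom]
  have hρφE : ∀ z, ρ (φEQ.baseChange ℂ z) = pullbackOne A φE (ρ z) := fun z => by
    rw [hρ, ofRatClassBaseChangeEquiv_apply, ofRatClassBaseChangeEquiv_apply, hφEQdef,
      ofRatClassBaseChange_baseChange_bettiMapHom]
  -- the CM data on `H¹(A(ℂ); ℚ)`
  have hφEE : φEQ ∈ (BettiUniverse.hodge hHD (AbelianVariety.isSmoothProjective_holds (A := A)) 1).endAlg := by
    have h := unop_bettiRep_mem_endAlg hHD hI (AbelianVariety.endAlgebra.of A φE)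
    rwa [bettiRep_of, MulOpposite.unop_op] at h
  have hVC : Module.finrank ℂ (ℂ ⊗[ℚ] bettiCohomology A.X 1) = Fintype.card (ι × Fin 2) * n₀ := by
    rw [Module.finrank_baseChange, finrank_bettiCohomology_one A, hdim, Fintype.card_prod, Fintype.card_fin]; ring
  set ev : ι × Fin 2 → ℂ := fun kt => if kt.2 = 0 then μ kt.1 else starRingEnd ℂ (μ kt.1) with hevdef
  have hev0 : ∀ k, ev (k, 0) = μ k := fun k => by simp [hevdef]
  have hev1 : ∀ k, ev (k, 1) = starRingEnd ℂ (μ k) := fun k => by simp [hevdef]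
  have hev : Function.Injective ev := by
    rintro ⟨k, t⟩ ⟨k', t'⟩ h
    rcases fin2_cases₅ t with rfl | rfl <;> rcases fin2_cases₅ t' with rfl | rfl
    · rw [hev0, hev0] at h; rw [hinj h]
    · rw [hev0, hev1] at h; exact absurd h (hdist k' k)
    · rw [hev1, hev0] at h; exact absurd h.symm (hdist k k')
    · rw [hev1, hev1] at h; rw [hinj ((starRingEnd ℂ).injective h)]
  have hgr := fun cc => CMTheta.finrank_eigenspace_eq_add
    (BettiUniverse.hodge hHD (AbelianVariety.isSmoothProjective_holds (A := A)) 1) Nat.cast_one heff hφEE cc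
  have h10 : ∀ cc, Module.finrank ℂ ↥(Module.End.eigenspace (φEQ.baseChange ℂ) cc ⊓
      (BettiUniverse.hodge hHD (AbelianVariety.isSmoothProjective_holds (A := A)) 1).piece 1 0) =
        eigenMultiplicity A φE cc := fun cc => by
    rw [hφEQdef, finrank_eigenspace_inf_piece_oneZero_eq_eigenMultiplicity hHD hI φE cc]
  have h01 : ∀ cc, Module.finrank ℂ ↥(Module.End.eigenspace (φEQ.baseChange ℂ) cc ⊓
      (BettiUniverse.hodge hHD (AbelianVariety.isSmoothProjective_holds (A := A)) 1).piece 0 1) =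
        eigenMultiplicity A φE (starRingEnd ℂ cc) := fun cc => by
    rw [hφEQdef, finrank_eigenspace_inf_piece_zeroOne_eq_eigenMultiplicity_conj hHD hI φE cc]
  have hfin : ∀ kt, Module.finrank ℂ ↥(Module.End.eigenspace (φEQ.baseChange ℂ) (ev kt)) = n₀ := by
    rintro ⟨k, t⟩
    rw [hgr, h10, h01]
    rcases fin2_cases₅ t with rfl | rfl
    · rw [hev0]; exact hmult k
    · rw [hev1, starRingEnd_self_apply, add_comm]; exact hmult k
  have hWne : ∀ kt, Module.End.eigenspace (φEQ.baseChange ℂ) (ev kt) ≠ ⊥ := by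
    intro kt hkt
    have h := hfin kt
    rw [hkt, finrank_bot] at h
    omega
  have hcard : Fintype.card (ι × Fin 2) = 2 * Fintype.card ι := by
    rw [Fintype.card_prod, Fintype.card_fin, mul_comm]
  set eι : ι × Fin 2 ≃ Fin (2 * Fintype.card ι) := Fintype.equivFinOfCardEq hcard with heιdef
  have hEφ := exists_eq_sum_smul_pow_bettiMapHom_fin hHD hI φE hEcard (ev ∘ eι.symm) (hev.comp eι.symm.injective)
    fun j => hWne (eι.symm j)
  have hrank : ∀ k, Module.finrank ℂ ↥(Module.End.eigenspace (φEQ.baseChange ℂ) (μ k) ⊓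
      (BettiUniverse.hodge hHD (AbelianVariety.isSmoothProjective_holds (A := A)) 1).piece 1 0) +
      Module.finrank ℂ ↥(Module.End.eigenspace (φEQ.baseChange ℂ) (μ k) ⊓
      (BettiUniverse.hodge hHD (AbelianVariety.isSmoothProjective_holds (A := A)) 1).piece 0 1) = n₀ := fun k => by
    rw [h10, h01]; exact hmult k
  have htop : (⨆ kt : ι × Fin 2, Module.End.eigenspace (φEQ.baseChange ℂ) (ev kt)) = ⊤ := by
    have hind : iSupIndep fun kt => Module.End.eigenspace (φEQ.baseChange ℂ) (ev kt) :=
      (Module.End.eigenspaces_iSupIndep (φEQ.baseChange ℂ)).comp hev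
    apply Submodule.eq_top_of_finrank_eq
    have h := Motives.finrank_biSup_eq_sum_of_iSupIndep hind Finset.univ
    have hs : (⨆ kt ∈ (Finset.univ : Finset (ι × Fin 2)), Module.End.eigenspace (φEQ.baseChange ℂ) (ev kt)) =
        ⨆ kt, Module.End.eigenspace (φEQ.baseChange ℂ) (ev kt) := by simp
    rw [hs] at h
    rw [h, hVC, Finset.sum_congr rfl fun kt _ => hfin kt, Finset.sum_const, Finset.card_univ, smul_eq_mul]
  obtain ⟨cb, κ, hcbW, hcbW', hcb0, hcb1, hdual, hiso⟩ := CMTheta.exists_adaptedDualBasis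
    (BettiUniverse.hodge hHD (AbelianVariety.isSmoothProjective_holds (A := A)) 1) Nat.cast_one heff ψ hφEE hEφ μ
    hinj hdist hrank htop
  have hKcb : ∀ k ℓ, cb ((k, 0), ℓ) ∈ Module.End.eigenspace (φQ.baseChange ℂ) μK := fun k ℓ => hKE k (hcbW k ℓ)
  have hKcb' : ∀ k ℓ, cb ((k, 1), ℓ) ∈ Module.End.eigenspace (φQ.baseChange ℂ) (-μK) := fun k ℓ => hKE' k (hcbW' k ℓ)
  have hφEcb : ∀ (kt : ι × Fin 2) ℓ, φEQ.baseChange ℂ (cb (kt, ℓ)) = ev kt • cb (kt, ℓ) := by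
    rintro ⟨k, t⟩ ℓ
    rcases fin2_cases₅ t with rfl | rfl
    · rw [hev0]; exact Module.End.mem_eigenspace_iff.1 (hcbW k ℓ)
    · rw [hev1]; exact Module.End.mem_eigenspace_iff.1 (hcbW' k ℓ)
  set evK : ι × Fin 2 → ℂ := fun kt => if kt.2 = 0 then μK else -μK with hevKdef
  have hφKcb : ∀ (kt : ι × Fin 2) ℓ, φQ.baseChange ℂ (cb (kt, ℓ)) = evK kt • cb (kt, ℓ) := by
    rintro ⟨k, t⟩ ℓ
    rcases fin2_cases₅ t with rfl | rfl
    · simp only [hevKdef, if_pos rfl]; exact Module.End.mem_eigenspace_iff.1 (hKcb k ℓ)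
    · simp only [hevKdef, if_neg one_ne_zero]; exact Module.End.mem_eigenspace_iff.1 (hKcb' k ℓ)
  -- the letters in `H¹(A(ℂ); ℂ)`
  set xb : Module.Basis ((ι × Fin 2) × Fin n₀) ℂ (complexBetti A.X 1) := cb.map ρ with hxb
  have hxb_apply : ∀ tl, xb tl = ρ (cb tl) := fun tl => by rw [hxb, Module.Basis.map_apply]
  have hφExb : ∀ (kt : ι × Fin 2) ℓ, pullbackOne A φE (xb (kt, ℓ)) = ev kt • xb (kt, ℓ) := fun kt ℓ => by
    rw [hxb_apply, ← hρφE, hφEcb, map_smul]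
  have hφxb : ∀ (kt : ι × Fin 2) ℓ, pullbackOne A φ (xb (kt, ℓ)) = evK kt • xb (kt, ℓ) := fun kt ℓ => by
    rw [hxb_apply, ← hρφ, hφKcb, map_smul]
  -- `u` commutes with `φ^*`, `φ_E^*`; its blocks `M k` on `W_{μ k}`
  have huφ : ∀ z, u (pullbackOne A φ z) = pullbackOne A φ (u z) := fun z => (mem_centralizerGroup_iff.1 hu.1) φ z
  have huφE : ∀ z, u (pullbackOne A φE z) = pullbackOne A φE (u z) := fun z => (mem_centralizerGroup_iff.1 hu.1) φE z
  have huWk : ∀ kt, ∀ x ∈ Module.End.eigenspace (pullbackOne A φE) (ev kt),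
      (u : complexBetti A.X 1 →ₗ[ℂ] complexBetti A.X 1) x ∈ Module.End.eigenspace (pullbackOne A φE) (ev kt) :=
    fun kt x hx => VanGeemen1994.mapsTo_eigenspace_of_comm huφE (ev kt) hx
  have hbkc : ∀ kt : ι × Fin 2, ∃ bW : Module.Basis (Fin n₀) ℂ (Module.End.eigenspace (pullbackOne A φE) (ev kt)),
      ∀ ℓ, (bW ℓ : complexBetti A.X 1) = xb (kt, ℓ) := fun kt =>
    exists_basis_eigenspace_of_blocks xb hφExb kt rfl fun τ hτ h => hτ (hev h)
  choose bkc hbkc using hbkc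
  have hxbWk : ∀ (kt : ι × Fin 2) ℓ, xb (kt, ℓ) ∈ Module.End.eigenspace (pullbackOne A φE) (ev kt) := fun kt ℓ =>
    Module.End.mem_eigenspace_iff.2 (hφExb kt ℓ)
  set M : ι → Matrix (Fin n₀) (Fin n₀) ℂ := fun k =>
    Matrix.of fun r ℓ => (bkc (k, 0)).repr ⟨u (xb ((k, 0), ℓ)), huWk _ _ (hxbWk (k, 0) ℓ)⟩ r with hMdef
  have hMu : ∀ k ℓ, u (xb ((k, 0), ℓ)) = ∑ r, M k r ℓ • xb ((k, 0), r) := fun k ℓ => by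
    have hs := congrArg Subtype.val ((bkc (k, 0)).sum_repr ⟨u (xb ((k, 0), ℓ)), huWk _ _ (hxbWk (k, 0) ℓ)⟩)
    rw [Submodule.coe_sum] at hs
    change _ = u (xb ((k, 0), ℓ)) at hs
    rw [← hs]
    exact Finset.sum_congr rfl fun r _ => by rw [Submodule.coe_smul, hbkc]; rfl
  -- `det(u | W_K) = ∏ det (M k) = 1`
  set eW : Fin 2 × (Fin n₀ × ι) ≃ (ι × Fin 2) × Fin n₀ :=
    { toFun := fun x => ((x.2.2, x.1), x.2.1)
      invFun := fun y => (y.1.2, (y.2, y.1.1))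
      left_inv := fun x => rfl
      right_inv := fun y => rfl } with heW
  set xbW : Module.Basis (Fin 2 × (Fin n₀ × ι)) ℂ (complexBetti A.X 1) := xb.reindex eW.symm with hxbWdef
  have hxbW_apply : ∀ (t : Fin 2) (r : Fin n₀) (k : ι), xbW (t, (r, k)) = xb ((k, t), r) := fun t r k => by
    rw [hxbWdef, Module.Basis.reindex_apply, Equiv.symm_symm]
    rfl
  obtain ⟨bWc, hbWc⟩ := exists_basis_eigenspace_of_blocks xbW (f := pullbackOne A φ) (ε := ![μK, -μK])
    (fun t rk => by
      obtain ⟨r, k⟩ := rk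
      rw [hxbW_apply, hφxb]
      rcases fin2_cases₅ t with rfl | rfl
      · simp [hevKdef]
      · simp [hevKdef])
    0 (μ := μK) (by simp) (fun t ht => by
      rcases fin2_cases₅ t with rfl | rfl
      · exact absurd rfl ht
      · simpa using hμKne)
  have hbWc' : ∀ rk : Fin n₀ × ι, (bWc rk : complexBetti A.X 1) = xb ((rk.2, 0), rk.1) := fun rk => by
    rw [hbWc, hxbW_apply]
  have huW : ∀ rk : Fin n₀ × ι, (u : complexBetti A.X 1 →ₗ[ℂ] complexBetti A.X 1) (xb ((rk.2, 0), rk.1)) =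
      ∑ x : Fin n₀ × ι, Matrix.blockDiagonal M x rk • xb ((x.2, 0), x.1) := by
    rintro ⟨ℓ, k⟩
    rw [LinearEquiv.coe_coe, hMu, Fintype.sum_prod_type_right, Finset.sum_eq_single k]
    · exact Finset.sum_congr rfl fun r _ => by rw [Matrix.blockDiagonal_apply_eq]
    · intro k' _ hk'
      exact Finset.sum_eq_zero fun r _ => by rw [Matrix.blockDiagonal_apply_ne _ _ _ hk', zero_smul]
    · intro hk; exact absurd (Finset.mem_univ k) hk
  have hdetM : ∏ k, (M k).det = 1 := by
    rw [← Matrix.det_blockDiagonal, ← hdet]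
    unfold detOnEigenspace
    rw [← LinearMap.det_toMatrix bWc, toMatrix_restrict_eq_of_apply_eq_sum' bWc hbWc' _ (Matrix.blockDiagonal M) huW]
  have hMd : ∀ k, (M k).det ≠ 0 := fun k hk => by
    rw [Finset.prod_eq_zero (Finset.mem_univ k) hk] at hdetM
    exact zero_ne_one hdetM
  have hMunit : ∀ k, IsUnit (M k).det := fun k => isUnit_iff_ne_zero.2 (hMd k)
  have hMinvM : ∀ k, (M k)⁻¹ * M k = 1 := fun k => Matrix.nonsing_inv_mul _ (hMunit k)
  -- the operator `v₀ = ⊕_k (M k ⊕ (M k⁻¹)ᵀ)` on `V_ℂ`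
  set Gm : ι × Fin 2 → Matrix (Fin n₀) (Fin n₀) ℂ := fun kt => if kt.2 = 0 then M kt.1 else ((M kt.1)⁻¹)ᵀ with hGm
  have hGm0 : ∀ k, Gm (k, 0) = M k := fun k => by simp [hGm]
  have hGm1 : ∀ k, Gm (k, 1) = ((M k)⁻¹)ᵀ := fun k => by simp [hGm]
  set cbr : Module.Basis (Fin n₀ × (ι × Fin 2)) ℂ (ℂ ⊗[ℚ] bettiCohomology A.X 1) :=
    cb.reindex (Equiv.prodComm (ι × Fin 2) (Fin n₀)) with hcbr
  have hcbr_apply : ∀ ℓ kt, cbr (ℓ, kt) = cb (kt, ℓ) := fun ℓ kt => by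
    rw [hcbr, Module.Basis.reindex_apply]; rfl
  set P : Matrix (Fin n₀ × (ι × Fin 2)) (Fin n₀ × (ι × Fin 2)) ℂ := Matrix.blockDiagonal Gm with hP
  have hPunit : IsUnit (LinearMap.toMatrix cbr cbr (Matrix.toLin cbr cbr P)).det := by
    rw [LinearMap.toMatrix_toLin, hP, Matrix.det_blockDiagonal]
    refine isUnit_iff_ne_zero.2 (Finset.prod_ne_zero_iff.2 fun kt _ => ?_)
    obtain ⟨k, t⟩ := kt
    rcases fin2_cases₅ t with rfl | rfl
    · rw [hGm0]; exact hMd k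
    · rw [hGm1, Matrix.det_transpose]
      exact (Matrix.isUnit_nonsing_inv_det_iff.2 (hMunit k)).ne_zero
  set v₀ : (ℂ ⊗[ℚ] bettiCohomology A.X 1) ≃ₗ[ℂ] (ℂ ⊗[ℚ] bettiCohomology A.X 1) :=
    LinearEquiv.ofIsUnitDet hPunit with hv₀
  have hv₀cb : ∀ kt ℓ, v₀ (cb (kt, ℓ)) = ∑ r, Gm kt r ℓ • cb (kt, r) := fun kt ℓ => by
    rw [hv₀, LinearEquiv.ofIsUnitDet_apply, ← hcbr_apply, Matrix.toLin_self, Fintype.sum_prod_type_right,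
      Finset.sum_eq_single kt]
    · exact Finset.sum_congr rfl fun r _ => by rw [hP, Matrix.blockDiagonal_apply_eq, hcbr_apply]
    · intro kt' _ hkt'
      exact Finset.sum_eq_zero fun r _ => by rw [hP, Matrix.blockDiagonal_apply_ne _ _ _ hkt', zero_smul]
    · intro hkt; exact absurd (Finset.mem_univ kt) hkt
  -- `v₀` commutes with `φ_{E,ℂ}` and `φ_ℂ`
  have hv₀φE : (v₀ : Module.End ℂ (ℂ ⊗[ℚ] bettiCohomology A.X 1)) * φEQ.baseChange ℂ =
      φEQ.baseChange ℂ * (v₀ : Module.End ℂ (ℂ ⊗[ℚ] bettiCohomology A.X 1)) := by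
    refine cb.ext fun tl => ?_
    obtain ⟨kt, ℓ⟩ := tl
    rw [Module.End.mul_apply, Module.End.mul_apply, LinearEquiv.coe_coe, hφEcb, map_smul, hv₀cb, map_sum,
      Finset.smul_sum]
    exact Finset.sum_congr rfl fun r _ => by rw [map_smul, hφEcb, smul_comm]
  have hv₀φ : (v₀ : Module.End ℂ (ℂ ⊗[ℚ] bettiCohomology A.X 1)) * φQ.baseChange ℂ =
      φQ.baseChange ℂ * (v₀ : Module.End ℂ (ℂ ⊗[ℚ] bettiCohomology A.X 1)) := by
    refine cb.ext fun tl => ?_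
    obtain ⟨kt, ℓ⟩ := tl
    rw [Module.End.mul_apply, Module.End.mul_apply, LinearEquiv.coe_coe, hφKcb, map_smul, hv₀cb, map_sum,
      Finset.smul_sum]
    exact Finset.sum_congr rfl fun r _ => by rw [map_smul, hφKcb, smul_comm]
  -- `v₀` preserves `ψ_ℂ`
  set ψC := ψ.form.baseChange ℂ with hψC
  have hswap : ∀ x y, ψC y x = -ψC x y := fun x y => by
    rw [hψC, ψ.form_baseChange_swap, show (((1 : ℕ) : ℤ)).negOnePow = -1 from Int.negOnePow_one]
    simp
  have hdual_same : ∀ k i j, ψC (cb ((k, 0), i)) (cb ((k, 1), j)) = if i = j then 1 else 0 := fun k i j => by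
    rw [hψC, hdual]; simp
  have hswap_same : ∀ k i j, ψC (cb ((k, 1), i)) (cb ((k, 0), j)) = -(if j = i then 1 else 0) := fun k i j => by
    rw [hswap, hdual_same]
  have hpair0 : ∀ k₁ k₂ (t₁ t₂ : Fin 2) i j, k₁ ≠ k₂ → ψC (cb ((k₁, t₁), i)) (cb ((k₂, t₂), j)) = 0 := by
    intro k₁ k₂ t₁ t₂ i j hk
    rcases fin2_cases₅ t₁ with rfl | rfl <;> rcases fin2_cases₅ t₂ with rfl | rfl
    · exact hiso k₁ k₂ 0 i j
    · rw [hψC, hdual, if_neg (fun h => hk h.1)]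
    · rw [hswap, hψC, hdual, if_neg (fun h => hk h.1.symm), neg_zero]
    · exact hiso k₁ k₂ 1 i j
  have hv₀ψ : ∀ x y, ψC (v₀ x) (v₀ y) = ψC x y := by
    have hB : ψC.compl₁₂ (v₀ : Module.End ℂ (ℂ ⊗[ℚ] bettiCohomology A.X 1))
        (v₀ : Module.End ℂ (ℂ ⊗[ℚ] bettiCohomology A.X 1)) = ψC := by
      refine LinearMap.BilinForm.ext_basis cb fun x₁ x₂ => ?_
      obtain ⟨⟨k₁, t₁⟩, i⟩ := x₁
      obtain ⟨⟨k₂, t₂⟩, j⟩ := x₂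
      rw [LinearMap.compl₁₂_apply, LinearEquiv.coe_coe, hv₀cb, hv₀cb, bilin_apply_sum_smul_sum_smul']
      by_cases hk12 : k₁ = k₂
      · subst hk12
        rcases fin2_cases₅ t₁ with rfl | rfl <;> rcases fin2_cases₅ t₂ with rfl | rfl
        · simp only [hiso, smul_zero, Finset.sum_const_zero]
        · have e1 : ∀ r : Fin n₀, ∑ s, (Gm (k₁, 0) r i * Gm (k₁, 1) s j) • ψC (cb ((k₁, 0), r)) (cb ((k₁, 1), s)) =
              M k₁ r i * (M k₁)⁻¹ j r := by
            intro r
            rw [Finset.sum_eq_single r]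
            · rw [hdual_same, if_pos rfl, smul_eq_mul, mul_one, hGm0, hGm1, Matrix.transpose_apply]
            · intro s _ hs; rw [hdual_same, if_neg (Ne.symm hs), smul_zero]
            · intro hr; exact absurd (Finset.mem_univ r) hr
          have e2 : ∑ r, M k₁ r i * (M k₁)⁻¹ j r = ((M k₁)⁻¹ * M k₁) j i := by
            rw [Matrix.mul_apply]; exact Finset.sum_congr rfl fun r _ => mul_comm _ _
          rw [Finset.sum_congr rfl fun r _ => e1 r, e2, hMinvM, Matrix.one_apply, hdual_same]
          by_cases hij : i = j
          · rw [if_pos hij, if_pos hij.symm]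
          · rw [if_neg hij, if_neg (Ne.symm hij)]
        · have e1 : ∀ r : Fin n₀, ∑ s, (Gm (k₁, 1) r i * Gm (k₁, 0) s j) • ψC (cb ((k₁, 1), r)) (cb ((k₁, 0), s)) =
              -((M k₁)⁻¹ i r * M k₁ r j) := by
            intro r
            rw [Finset.sum_eq_single r]
            · rw [hswap_same, if_pos rfl, smul_neg, smul_eq_mul, mul_one, hGm0, hGm1, Matrix.transpose_apply]
            · intro s _ hs; rw [hswap_same, if_neg hs, neg_zero, smul_zero]
            · intro hr; exact absurd (Finset.mem_univ r) hr
          have e2 : ∑ r, -((M k₁)⁻¹ i r * M k₁ r j) = -((M k₁)⁻¹ * M k₁) i j := by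
            rw [Finset.sum_neg_distrib, Matrix.mul_apply]
          rw [Finset.sum_congr rfl fun r _ => e1 r, e2, hMinvM, Matrix.one_apply, hswap_same]
          by_cases hij : i = j
          · rw [if_pos hij, if_pos hij.symm]
          · rw [if_neg hij, if_neg (Ne.symm hij)]
        · simp only [hiso, smul_zero, Finset.sum_const_zero]
      · simp only [hpair0 k₁ k₂ _ _ _ _ hk12, smul_zero, Finset.sum_const_zero]
    intro x y
    have e := LinearMap.congr_fun (LinearMap.congr_fun hB x) y
    rw [LinearMap.compl₁₂_apply, LinearEquiv.coe_coe] at e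
    exact e
  -- `det(v₀ | W_K) = ∏ det (M k) = 1`
  set cbW : Module.Basis (Fin 2 × (Fin n₀ × ι)) ℂ (ℂ ⊗[ℚ] bettiCohomology A.X 1) := cb.reindex eW.symm with hcbWdef
  have hcbW_apply : ∀ (t : Fin 2) (r : Fin n₀) (k : ι), cbW (t, (r, k)) = cb ((k, t), r) := fun t r k => by
    rw [hcbWdef, Module.Basis.reindex_apply, Equiv.symm_symm]
    rfl
  obtain ⟨bW, hbW⟩ := exists_basis_eigenspace_of_blocks cbW (f := φQ.baseChange ℂ) (ε := ![μK, -μK])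
    (fun t rk => by
      obtain ⟨r, k⟩ := rk
      rw [hcbW_apply, hφKcb]
      rcases fin2_cases₅ t with rfl | rfl
      · simp [hevKdef]
      · simp [hevKdef])
    0 (μ := μK) (by simp) (fun t ht => by
      rcases fin2_cases₅ t with rfl | rfl
      · exact absurd rfl ht
      · simpa using hμKne)
  have hbW' : ∀ rk : Fin n₀ × ι, (bW rk : ℂ ⊗[ℚ] bettiCohomology A.X 1) = cb ((rk.2, 0), rk.1) := fun rk => by
    rw [hbW, hcbW_apply]
  have hv₀W : ∀ rk : Fin n₀ × ι, (v₀ : Module.End ℂ (ℂ ⊗[ℚ] bettiCohomology A.X 1)) (cb ((rk.2, 0), rk.1)) =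
      ∑ x : Fin n₀ × ι, Matrix.blockDiagonal M x rk • cb ((x.2, 0), x.1) := by
    rintro ⟨ℓ, k⟩
    rw [LinearEquiv.coe_coe, hv₀cb, hGm0, Fintype.sum_prod_type_right, Finset.sum_eq_single k]
    · exact Finset.sum_congr rfl fun r _ => by rw [Matrix.blockDiagonal_apply_eq]
    · intro k' _ hk'
      exact Finset.sum_eq_zero fun r _ => by rw [Matrix.blockDiagonal_apply_ne _ _ _ hk', zero_smul]
    · intro hk; exact absurd (Finset.mem_univ k) hk
  have hv₀det : LinearMap.det ((v₀ : Module.End ℂ (ℂ ⊗[ℚ] bettiCohomology A.X 1)).restrict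
      fun x (hx : x ∈ Module.End.eigenspace (φQ.baseChange ℂ) μK) =>
        UnitaryTheta.apply_mem_eigenspace_of_commute hv₀φ hx) = 1 := by
    rw [← LinearMap.det_toMatrix bW, toMatrix_restrict_eq_of_apply_eq_sum' bW hbW' _ (Matrix.blockDiagonal M) hv₀W,
      Matrix.det_blockDiagonal, hdetM]
  -- §2: the transport `v` of `v₀` lies in `Hg|_{H¹}`, hence in `S(A)(h)`
  have hvHg := hW.trans_mem_hodgeGroupOne_of_cmField_of_det_eq_one φE hEcard μ hinj hdist hn₀ hmult hdim hKE hKE' ψ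
    hSU hv₀φ hv₀φE hv₀ψ hv₀det
  set v : complexBetti A.X 1 ≃ₗ[ℂ] complexBetti A.X 1 := ρ.symm.trans (v₀.trans ρ) with hvdef
  have hv_apply : ∀ z, v z = ρ (v₀ (ρ.symm z)) := fun z => rfl
  have hvS : v ∈ unitaryCentralizerGroup A h := hodgeGroupOne_le_unitaryCentralizerGroup hh hvHg
  have hvxb : ∀ kt ℓ, v (xb (kt, ℓ)) = ∑ r, Gm kt r ℓ • xb (kt, r) := fun kt ℓ => by
    rw [hxb_apply, hv_apply, ρ.symm_apply_apply, hv₀cb, map_sum]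
    exact Finset.sum_congr rfl fun r _ => by rw [map_smul, hxb_apply]
  -- `u = v`: they agree on the letters of `W_K` …
  have huv0 : ∀ k ℓ, u (xb ((k, 0), ℓ)) = v (xb ((k, 0), ℓ)) := fun k ℓ => by rw [hMu, hvxb, hGm0]
  -- … `W̄_K` is `Q_h`-isotropic …
  have hisoQ : ∀ y ∈ Module.End.eigenspace (pullbackOne A φ) (-μK), ∀ y' ∈ Module.End.eigenspace (pullbackOne A φ) (-μK),
      Q y y' = 0 := by
    intro y hy y' hy'
    rw [Module.End.mem_eigenspace_iff] at hy hy'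
    have h1 := hφQ y y'
    rw [hy, hy', map_smul, LinearMap.map_smul₂, smul_smul, neg_mul_neg, hμK2] at h1
    have h2 : ((2 : ℂ) * (d : ℂ)) • Q y y' = 0 := by
      rw [mul_smul, two_smul]
      nth_rw 1 [← h1]
      rw [neg_smul, neg_add_cancel]
    rcases smul_eq_zero.1 h2 with h3 | h3
    · exfalso
      exact mul_ne_zero two_ne_zero (Nat.cast_ne_zero.2 hW.d_pos.ne') h3
    · exact h3
  have hxbW' : ∀ k ℓ, xb ((k, 1), ℓ) ∈ Module.End.eigenspace (pullbackOne A φ) (-μK) := fun k ℓ =>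
    Module.End.mem_eigenspace_iff.2 (by rw [hφxb]; simp [hevKdef])
  have hvφ : ∀ z, v (pullbackOne A φ z) = pullbackOne A φ (v z) := fun z => (mem_centralizerGroup_iff.1 hvS.1) φ z
  -- … so they agree on the letters of `W̄_K` (`Q_h` non-degenerate)
  have huv1 : ∀ k ℓ, u (xb ((k, 1), ℓ)) = v (xb ((k, 1), ℓ)) := by
    intro k ℓ
    rw [← sub_eq_zero]
    apply hnd
    suffices hcomp : Q (u (xb ((k, 1), ℓ)) - v (xb ((k, 1), ℓ))) ∘ₗ (u : complexBetti A.X 1 →ₗ[ℂ] complexBetti A.X 1) = 0 by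
      intro y
      obtain ⟨z, rfl⟩ := u.surjective y
      have e := LinearMap.congr_fun hcomp z
      rwa [LinearMap.comp_apply, LinearEquiv.coe_coe, LinearMap.zero_apply] at e
    refine xb.ext fun x₁ => ?_
    obtain ⟨⟨k', t⟩, j⟩ := x₁
    rw [LinearMap.comp_apply, LinearEquiv.coe_coe, LinearMap.zero_apply, map_sub, LinearMap.sub_apply]
    rcases fin2_cases₅ t with rfl | rfl
    · rw [hu.2, huv0, hvS.2, sub_self]
    · have hmem : ∀ w : complexBetti A.X 1 ≃ₗ[ℂ] complexBetti A.X 1, (∀ z, w (pullbackOne A φ z) = pullbackOne A φ (w z)) →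
          ∀ k'' ℓ', w (xb ((k'', 1), ℓ')) ∈ Module.End.eigenspace (pullbackOne A φ) (-μK) :=
        fun w hw k'' ℓ' => VanGeemen1994.mapsTo_eigenspace_of_comm hw (-μK) (hxbW' k'' ℓ')
      rw [hisoQ _ (hmem u huφ k ℓ) _ (hmem u huφ k' j), hisoQ _ (hmem v hvφ k ℓ) _ (hmem u huφ k' j), sub_self]
  have huv : u = v := by
    refine LinearEquiv.ext fun z => ?_
    have e : (u : complexBetti A.X 1 →ₗ[ℂ] complexBetti A.X 1) = (v : complexBetti A.X 1 →ₗ[ℂ] complexBetti A.X 1) := by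
      refine xb.ext fun x₁ => ?_
      obtain ⟨⟨k, t⟩, ℓ⟩ := x₁
      rcases fin2_cases₅ t with rfl | rfl
      · exact huv0 k ℓ
      · exact huv1 k ℓ
    exact LinearMap.congr_fun e z
  rw [huv]
  exact hvHg

end SocketE

end Literature.AlgebraicGeometry.HodgeTheory

end
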